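import Literature.MathematicalPhysics.QuantumFieldTheory.AbelianHiggsTorusClustering
import Summits.QuantumFields.YangMills.Theses.ParabolicTrajectory

/-!
# Finite abelian lattice gauge theories: torus clustering at large `β` with EXPLICIT volume
# condition and `β`-uniform constants (support file for `Negative.FiniteGroupFalse`)

Crux `Summit.QuantumFields.YangMills.Theses.ParabolicTrajectory.TunedSequenceExists` (item
stmt-QuantumFields-10524; cdisprove gen 3). To kill would-be tuned witnesses (`β_k → ∞`, tori
`2L_k+1`, separations `M^{n_k}` with `L_k/M^{n_k} → ∞`) for FINITE ABELIAN gauge groups one needs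
the low-temperature clustering bound of the tree's contour expansion
(`Literature.MathematicalPhysics.QuantumFieldTheory.abelianHiggs_torus_clustering`: Kotecký–Preiss
for the vortex gas of a finite abelian group with an action gap) with constants UNIFORM in `β`
beyond the threshold and with an EXPLICIT (rather than eventual) condition on the torus size. This
file re-runs that theorem's assembly in exactly this form (`abelianHiggs_torus_clustering_explicit`):
there is `β_f` such that for all bounded gauge-invariant local `F₁, F₂` there are `C` and `R₀`
(depending on the observables only) with
`|⟨F₁ · (F₂ ∘ θ_x)⟩_{L+1,β} - ⟨F₁⟩⟨F₂ ∘ θ_x⟩| ≤ C e^{-‖x‖_∞}` for ALL `β > β_f`, all `x ∈ ℤ^d`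
and all `L` with `2‖x‖ + R₀ ≤ L` and `12 d² (L+1)^d 2^{-⌊(L+1)/2⌋} < e^{-‖x‖}` (the latter makes
the Peierls error of wrapping vortices `< e^{-‖x‖}/12`, using `4λ ≤ 1` for the activity in the
Kotecký–Preiss regime). All ingredients are the tree's; only the bookkeeping of the last step
differs.
-/

noncomputable section

namespace Summit.QuantumFields.YangMills.Theorems.TunedSequenceExists.Negative.FiniteAbelianClustering

section Explicit

open Finset Function Filter MeasureTheory
open scoped Topology
open Literature.MathematicalPhysics.QuantumLattice hiding IsLocalObservable
open Literature.Probability.LatticeModels (Torus.proj Torus.proj_apply IsPolymerCluster KPTouches GeomInc)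
open Literature.MathematicalPhysics.QuantumFieldTheory hiding IsLocalObservable
open Literature.MathematicalPhysics.QuantumFieldTheory.LatticeForm

/-- **Exponential clustering in the Higgs phase of finite abelian lattice gauge theories, torus
states, with EXPLICIT volume condition and `β`-uniform constants** (the assembly of
`abelianHiggs_torus_clustering` re-run: `C` and `R₀` depend on the observables only; the
eventual condition on the torus size is replaced by the two explicit inequalities, the second being
a sufficient condition for the smallness of the Peierls error `δ_L < e^{-‖x‖}/12` because the
activity satisfies `4λ ≤ 1` in the Kotecký–Preiss regime). -/
theorem abelianHiggs_torus_clustering_explicit {d N : ℕ} (hd : 3 ≤ d) {G : Type*} [CommGroup G]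
    [Fintype G] [DecidableEq G] [TopologicalSpace G] [DiscreteTopology G] [IsTopologicalGroup G]
    [MeasurableSpace G] [BorelSpace G] (ρ : G →* Matrix (Fin N) (Fin N) ℂ) (hρ : Continuous ρ)
    {δ : ℝ} (hδ : 0 < δ) (hgap : ∀ g : G, g ≠ 1 → δ ≤ (N : ℝ) - (ρ g).trace.re) :
    ∃ β_f : ℝ, ∀ F₁ F₂ : LGConfig d G → ℝ,
      Literature.MathematicalPhysics.QuantumLattice.IsLocalObservable F₁ →
      Literature.MathematicalPhysics.QuantumLattice.IsLocalObservable F₂ →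
      (∃ C, ∀ U, |F₁ U| ≤ C) → (∃ C, ∀ U, |F₂ U| ≤ C) →
      IsZdGaugeInvariant F₁ → IsZdGaugeInvariant F₂ →
      ∃ (C : ℝ) (R₀ : ℕ), ∀ β : ℝ, β_f < β →
        ∀ (x : Literature.Probability.LatticeModels.Site d) (L : ℕ),
        2 * ‖x‖ + (R₀ : ℝ) ≤ L →
        12 * ((d : ℝ) ^ 2 * ((L + 1 : ℕ) : ℝ) ^ d * (1 / 2 : ℝ) ^ ((L + 1) / 2)) < Real.exp (-‖x‖) →
        |wilsonExpectation (L := L + 1) ρ β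
              (toTorusObservable (L + 1) fun U => F₁ U * F₂ (configShift x U)) -
            wilsonExpectation (L := L + 1) ρ β (toTorusObservable (L + 1) F₁) *
              wilsonExpectation (L := L + 1) ρ β (toTorusObservable (L + 1) (F₂ ∘ configShift x))| ≤
          C * Real.exp (-1 * ‖x‖) := by
  classical
  -- the regime
  set Mc : ℝ := (Fintype.card (Additive G) : ℝ) with hMc
  obtain ⟨β₀, hβ₀0, hβ₀⟩ := eventually_kp_small d Mc hδ
  refine ⟨β₀, fun F₁ F₂ hloc₁ hloc₂ hbd₁ hbd₂ hG₁ hG₂ => ?_⟩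
  obtain ⟨S₁, hS₁⟩ := hloc₁
  obtain ⟨S₂, hS₂⟩ := hloc₂
  obtain ⟨C₁, hC₁⟩ := hbd₁
  obtain ⟨C₂, hC₂⟩ := hbd₂
  have hMc1 : 1 ≤ Mc := by
    rw [hMc]; exact_mod_cast Fintype.card_pos (α := Additive G)
  -- normalisation
  set c₁ : ℝ := max C₁ 1 with hc₁
  set c₂ : ℝ := max C₂ 1 with hc₂
  have hc₁pos : 0 < c₁ := lt_of_lt_of_le one_pos (le_max_right _ _)
  have hc₂pos : 0 < c₂ := lt_of_lt_of_le one_pos (le_max_right _ _)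
  set Fn₁ : LGConfig d G → ℝ := fun U => F₁ U / c₁ with hFn₁def
  set Fn₂ : LGConfig d G → ℝ := fun U => F₂ U / c₂ with hFn₂def
  have hFn₁ : ∀ U, |Fn₁ U| ≤ 1 := fun U => by
    rw [hFn₁def]; dsimp only
    rw [abs_div, abs_of_pos hc₁pos, div_le_one hc₁pos]
    exact (hC₁ U).trans (le_max_left _ _)
  have hFn₂ : ∀ U, |Fn₂ U| ≤ 1 := fun U => by
    rw [hFn₂def]; dsimp only
    rw [abs_div, abs_of_pos hc₂pos, div_le_one hc₂pos]
    exact (hC₂ U).trans (le_max_left _ _)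
  have hSn₁ : IsCylinder Fn₁ S₁ := fun U V hUV => by
    show F₁ U / c₁ = F₁ V / c₁; rw [hS₁ hUV]
  have hSn₂ : IsCylinder Fn₂ S₂ := fun U V hUV => by
    show F₂ U / c₂ = F₂ V / c₂; rw [hS₂ hUV]
  have hGn₁ : IsZdGaugeInvariant Fn₁ := fun g U => by
    show F₁ (gaugeTransformZd g U) / c₁ = F₁ U / c₁; rw [hG₁ g U]
  have hGn₂ : IsZdGaugeInvariant Fn₂ := fun g U => by
    show F₂ (gaugeTransformZd g U) / c₂ = F₂ U / c₂; rw [hG₂ g U]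
  -- the common cube
  obtain ⟨R, hR⟩ := exists_cube_of_finset (S₁ ∪ S₂)
  have hR₁ : ∀ e ∈ S₁, ∀ k : Fin d, (e.1 k).natAbs + 1 ≤ R := fun e he => hR e (Finset.mem_union_left _ he)
  have hR₂ : ∀ e ∈ S₂, ∀ k : Fin d, (e.1 k).natAbs + 1 ≤ R := fun e he => hR e (Finset.mem_union_right _ he)
  set a : Literature.Probability.LatticeModels.Site d := cst d (-(R : ℤ)) with ha
  set b : Literature.Probability.LatticeModels.Site d := cst d R with hb
  have hbox₁ : ∀ e ∈ S₁, e.1 ∈ Set.Icc a b ∧ e.1 + LatticeForm.e e.2 ∈ Set.Icc a b := sbox_of_cube hR₁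
  have hbox₂ : ∀ e ∈ S₂, e.1 ∈ Set.Icc a b ∧ e.1 + LatticeForm.e e.2 ∈ Set.Icc a b := sbox_of_cube hR₂
  -- constants
  set P : ℕ := (Finset.Icc a b).card * Fintype.card {p : Fin d × Fin d // p.1 < p.2} with hP
  set Γ₀ : ℝ := (2 * Mc) ^ P * (2 * Mc) ^ P * (6 * P * Real.exp (6 * P + 2 * P)) with hΓ₀
  have hΓ₀0 : 0 ≤ Γ₀ := by rw [hΓ₀]; positivity
  set Cfin : ℝ := max (c₁ * c₂ * (Γ₀ * Real.exp (4 * R + 1) + 1)) (2 * c₁ * c₂ * Real.exp (4 * R + 2))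
    with hCfin
  refine ⟨Cfin, 4 * R + 4, fun β hβ x L hLx hPe => ?_⟩
  -- the regime at `β`
  have hβ0 : 0 ≤ β := hβ₀0.trans hβ.le
  set ε : ℝ := Real.exp (-(β * δ)) with hε
  set φ : Additive G → ℝ := wilsonPhi ρ β with hφ
  have hsmallβ := hβ₀ β hβ.le
  have hKP : KPRegime d (Additive G) φ ε 1 := kpRegime_wilsonPhi ρ hβ0 hgap hsmallβ
  have hε0 : 0 ≤ ε := (Real.exp_pos _).le
  have hlam0 : 0 ≤ Mc * ε := mul_nonneg (by linarith) hε0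
  have hsmall2 : ((cubeDeg d : ℝ) + 1) ^ 2 * (2 * (Mc * ε)) ≤ 1 / 2 := by
    have he2 : (2 : ℝ) ≤ Real.exp (1 + 1) := by
      have := Real.add_one_le_exp (1 + 1 : ℝ); linarith
    have h1 : 2 * (Mc * ε) ≤ Mc * ε * Real.exp (1 + 1) := by nlinarith
    exact le_trans (mul_le_mul_of_nonneg_left h1 (by positivity)) hsmallβ
  -- the translated observable
  set Fn₂x : LGConfig d G → ℝ := Fn₂ ∘ configShift x with hFn₂xdef
  have hFn₂x : ∀ U, |Fn₂x U| ≤ 1 := fun U => hFn₂ _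
  have hSn₂x : IsCylinder Fn₂x (S₂.image fun e => (e.1 - x, e.2)) := IsCylinder.comp_configShift hSn₂ x
  have hGn₂x : IsZdGaugeInvariant Fn₂x := isZdGaugeInvariant_comp_configShift hGn₂ x
  have hbox₂x := sbox_shift hbox₂ x
  -- the axis of `‖x‖`
  have hne : (Finset.univ : Finset (Fin d)).Nonempty := Finset.univ_nonempty_iff.2 ⟨⟨0, by omega⟩⟩
  obtain ⟨k, -, hk⟩ := Finset.exists_max_image Finset.univ (fun j => (x j).natAbs) hne
  have hnorm : ‖x‖ = (x k).natAbs := norm_eq_natAbs_of_max x k fun j => hk j (Finset.mem_univ j)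
  set xk : ℕ := (x k).natAbs with hxk
  -- expectation identities (every torus size)
  have hscale : ∀ L : ℕ,
      wilsonExpectation (L := L + 1) ρ β (toTorusObservable (L + 1) fun U => F₁ U * F₂ (configShift x U)) -
        wilsonExpectation (L := L + 1) ρ β (toTorusObservable (L + 1) F₁) *
          wilsonExpectation (L := L + 1) ρ β (toTorusObservable (L + 1) (F₂ ∘ configShift x)) =
      (c₁ * c₂) * (exactAvgR (φ) (fun η => plaqObs (L + 1) Fn₁ (boxPlaqT (L + 1) a b) η *
            plaqObs (L + 1) Fn₂x (boxPlaqT (L + 1) (a - x) (b - x)) η) -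
          exactAvgR φ (plaqObs (L + 1) Fn₁ (boxPlaqT (L + 1) a b)) *
            exactAvgR φ (plaqObs (L + 1) Fn₂x (boxPlaqT (L + 1) (a - x) (b - x)))) := by
    intro L
    have e12 : (toTorusObservable (L + 1) fun U => F₁ U * F₂ (configShift x U)) =
        fun U => (c₁ * c₂) * toTorusObservable (L + 1) (fun U => Fn₁ U * Fn₂x U) U := by
      funext U
      simp only [toTorusObservable_apply, hFn₂xdef, hFn₁def, hFn₂def, Function.comp_apply]
      field_simp
    have e1 : toTorusObservable (L + 1) F₁ = fun U => c₁ * toTorusObservable (L + 1) Fn₁ U := by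
      funext U
      simp only [toTorusObservable_apply, hFn₁def]
      field_simp
    have e2 : toTorusObservable (L + 1) (F₂ ∘ configShift x) = fun U => c₂ * toTorusObservable (L + 1) Fn₂x U := by
      funext U
      simp only [toTorusObservable_apply, hFn₂xdef, hFn₂def, Function.comp_apply]
      field_simp
    rw [e12, e1, e2, wilsonExpectation_const_mul, wilsonExpectation_const_mul, wilsonExpectation_const_mul,
      wilsonExpectation_toTorusObservable_mul_eq ρ hρ β hGn₁ hGn₂x hSn₁ hSn₂x hbox₁ hbox₂x,
      wilsonExpectation_toTorusObservable_eq ρ hρ β hGn₁ hSn₁ hbox₁,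
      wilsonExpectation_toTorusObservable_eq ρ hρ β hGn₂x hSn₂x hbox₂x]
    ring
  -- trivial bound
  have hφ0 : φ 0 = 1 := hKP.zero
  have hφnn : ∀ a, 0 ≤ φ a := hKP.nonneg
  have habs₁ : ∀ (L : ℕ) (η : Plaquette d (L + 1) → Additive G), |plaqObs (L + 1) Fn₁ (boxPlaqT (L + 1) a b) η| ≤ 1 :=
    fun L η => hFn₁ _
  have habs₂ : ∀ (L : ℕ) (η : Plaquette d (L + 1) → Additive G),
      |plaqObs (L + 1) Fn₂x (boxPlaqT (L + 1) (a - x) (b - x)) η| ≤ 1 := fun L η => hFn₂x _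
  have htriv : ∀ L : ℕ,
      |exactAvgR (φ) (fun η => plaqObs (L + 1) Fn₁ (boxPlaqT (L + 1) a b) η *
            plaqObs (L + 1) Fn₂x (boxPlaqT (L + 1) (a - x) (b - x)) η) -
          exactAvgR φ (plaqObs (L + 1) Fn₁ (boxPlaqT (L + 1) a b)) *
            exactAvgR φ (plaqObs (L + 1) Fn₂x (boxPlaqT (L + 1) (a - x) (b - x)))| ≤ 2 := by
    intro L
    have h1 := abs_exactAvgR_le (d := d) (L := L + 1) hφ0 hφnn _ (habs₁ L)
    have h2 := abs_exactAvgR_le (d := d) (L := L + 1) hφ0 hφnn _ (habs₂ L)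
    have h12 := abs_exactAvgR_le (d := d) (L := L + 1) hφ0 hφnn
      (fun η => plaqObs (L + 1) Fn₁ (boxPlaqT (L + 1) a b) η *
        plaqObs (L + 1) Fn₂x (boxPlaqT (L + 1) (a - x) (b - x)) η) (fun η => by
        rw [abs_mul]; exact mul_le_one₀ (habs₁ L η) (abs_nonneg _) (habs₂ L η))
    have hprod : |exactAvgR φ (plaqObs (L + 1) Fn₁ (boxPlaqT (L + 1) a b)) *
        exactAvgR φ (plaqObs (L + 1) Fn₂x (boxPlaqT (L + 1) (a - x) (b - x)))| ≤ 1 := by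
      rw [abs_mul]; exact mul_le_one₀ h1 (abs_nonneg _) h2
    have := abs_sub _ _ |>.trans (add_le_add h12 hprod)
    linarith
  -- the explicit conditions on the torus size (in place of the eventual ones)
  have hLge : 2 * xk + 4 * R + 4 ≤ L + 1 := by
    have h' : 2 * ((xk : ℕ) : ℝ) + ((4 * R + 4 : ℕ) : ℝ) ≤ L := by rw [← hnorm]; exact hLx
    have h'' : ((2 * xk + 4 * R + 4 : ℕ) : ℝ) ≤ ((L : ℕ) : ℝ) := by push_cast at h' ⊢; linarith
    have h3 : 2 * xk + 4 * R + 4 ≤ L := by exact_mod_cast h''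
    omega
  have hlam41 : 4 * (Mc * ε) ≤ 1 := by
    have h1 : (1 : ℝ) ≤ ((cubeDeg d : ℝ) + 1) ^ 2 := by
      have h0 : (1 : ℝ) ≤ (cubeDeg d : ℝ) + 1 := by
        have := Nat.cast_nonneg (α := ℝ) (cubeDeg d); linarith
      nlinarith
    have h2 : 2 * (Mc * ε) ≤ ((cubeDeg d : ℝ) + 1) ^ 2 * (2 * (Mc * ε)) :=
      le_mul_of_one_le_left (by positivity) h1
    linarith
  have hpS : peierlsSum d (L + 1) (Mc * ε) ((L + 1) / 2) <
      min (1 / 2) (Real.exp (-(xk : ℝ)) / 12) := by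
    have h1 := peierlsSum_le (d := d) (L := L + 1) hlam0 hsmall2 ((L + 1) / 2)
    have hcard : (Fintype.card (Plaquette d (L + 1)) : ℝ) ≤ (d : ℝ) ^ 2 * ((L + 1 : ℕ) : ℝ) ^ d := by
      have := card_plaquette_le (d := d) (L := L + 1)
      exact_mod_cast this
    have hQ : peierlsSum d (L + 1) (Mc * ε) ((L + 1) / 2) ≤
        (d : ℝ) ^ 2 * ((L + 1 : ℕ) : ℝ) ^ d * (1 / 2 : ℝ) ^ ((L + 1) / 2) := by
      calc peierlsSum d (L + 1) (Mc * ε) ((L + 1) / 2)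
          ≤ (Fintype.card (Plaquette d (L + 1)) : ℝ) * (4 * (Mc * ε) * (1 / 2) ^ ((L + 1) / 2)) := h1
        _ ≤ ((d : ℝ) ^ 2 * ((L + 1 : ℕ) : ℝ) ^ d) * (1 * (1 / 2 : ℝ) ^ ((L + 1) / 2)) :=
            mul_le_mul hcard (mul_le_mul_of_nonneg_right hlam41 (by positivity)) (by positivity)
              (by positivity)
        _ = (d : ℝ) ^ 2 * ((L + 1 : ℕ) : ℝ) ^ d * (1 / 2 : ℝ) ^ ((L + 1) / 2) := by ring
    have hx : Real.exp (-‖x‖) = Real.exp (-(xk : ℝ)) := by rw [hnorm]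
    have hPe' : 12 * ((d : ℝ) ^ 2 * ((L + 1 : ℕ) : ℝ) ^ d * (1 / 2 : ℝ) ^ ((L + 1) / 2)) <
        Real.exp (-(xk : ℝ)) := hx ▸ hPe
    have hexle : Real.exp (-(xk : ℝ)) ≤ 1 := by
      rw [Real.exp_le_one_iff]
      have := Nat.cast_nonneg (α := ℝ) xk
      linarith
    refine lt_min ?_ ?_ <;> linarith
  rw [hscale L, abs_mul, abs_of_pos (mul_pos hc₁pos hc₂pos), hnorm]
  have hCfin1 : c₁ * c₂ * (Γ₀ * Real.exp (4 * R + 1) + 1) ≤ Cfin := le_max_left _ _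
  have hCfin2 : 2 * c₁ * c₂ * Real.exp (4 * R + 2) ≤ Cfin := le_max_right _ _
  by_cases hsmallx : xk < 4 * R + 2
  · -- trivial regime
    have hexp1 : 1 ≤ Real.exp (4 * R + 2) * Real.exp (-1 * (xk : ℝ)) := by
      rw [← Real.exp_add]
      have hlt : (xk : ℝ) < 4 * R + 2 := by exact_mod_cast hsmallx
      exact Real.one_le_exp (by linarith)
    calc c₁ * c₂ * |_| ≤ c₁ * c₂ * 2 := mul_le_mul_of_nonneg_left (htriv L) (by positivity)
      _ ≤ c₁ * c₂ * 2 * (Real.exp (4 * R + 2) * Real.exp (-1 * (xk : ℝ))) :=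
          le_mul_of_one_le_right (by positivity) hexp1
      _ = (2 * c₁ * c₂ * Real.exp (4 * R + 2)) * Real.exp (-1 * (xk : ℝ)) := by ring
      _ ≤ Cfin * Real.exp (-1 * (xk : ℝ)) := mul_le_mul_of_nonneg_right hCfin2 (Real.exp_nonneg _)
  · -- contour expansion regime
    push Not at hsmallx
    set B₁ := boxPlaqT (L + 1) a b with hB₁def
    set B₂ := boxPlaqT (L + 1) (a - x) (b - x) with hB₂def
    set f₁ := plaqObs (L + 1) Fn₁ B₁ with hf₁def
    set f₂ := plaqObs (L + 1) Fn₂x B₂ with hf₂def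
    -- levels
    have hB₁lev : ∀ p ∈ B₁, torusLevel k (((-(R : ℤ)) : ℤ) : ZMod (L + 1)) p ≤ 2 * R := fun p hp =>
      torusLevel_le_of_mem_boxPlaqT k (-(R : ℤ)) (fun y hy => by
        have h1 : a k ≤ y k := hy.1 k
        have h2 : y k ≤ b k := hy.2 k
        simp only [ha, hb, cst] at h1 h2
        omega) (by omega) hp
    have hB₂lev : ∀ p ∈ B₂, xk - 2 * R ≤ torusLevel k (((-(R : ℤ)) : ℤ) : ZMod (L + 1)) p := fun p hp =>
      le_torusLevel_of_mem_boxPlaqT k (-(R : ℤ)) (fun y hy => by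
        have h1 : (a - x) k ≤ y k := hy.1 k
        have h2 : y k ≤ (b - x) k := hy.2 k
        simp only [ha, hb, cst, Pi.sub_apply] at h1 h2
        constructor <;> omega) hp
    have huv : 2 * R + 1 ≤ xk - 2 * R := by omega
    have hδhalf : peierlsSum d (L + 1) ((Fintype.card (Additive G) : ℝ) * ε) ((L + 1) / 2) ≤ 1 / 2 :=
      (hpS.trans_le (min_le_left _ _)).le
    have hmain := hKP.norm_exactCov_le hd (g₁ := fun η => (f₁ η : ℂ)) (g₂ := fun η => (f₂ η : ℂ))
      (isDet_plaqObs Fn₁ B₁) (isDet_plaqObs Fn₂x B₂) (norm_plaqObs_le hFn₁ B₁) (norm_plaqObs_le hFn₂x B₂)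
      k (((-(R : ℤ)) : ℤ) : ZMod (L + 1)) hB₁lev hB₂lev huv hδhalf
    -- identify the left-hand side
    have hlhs : ‖exactAvg φ (fun η => ((f₁ η : ℂ)) * (f₂ η : ℂ)) - exactAvg φ (fun η => (f₁ η : ℂ)) *
        exactAvg φ (fun η => (f₂ η : ℂ))‖ =
        |exactAvgR φ (fun η => f₁ η * f₂ η) - exactAvgR φ f₁ * exactAvgR φ f₂| := by
      have : (fun η => ((f₁ η : ℂ)) * (f₂ η : ℂ)) = fun η => ((f₁ η * f₂ η : ℝ) : ℂ) := by
        funext η; push_cast; rfl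
      rw [this, exactAvg_ofReal, exactAvg_ofReal, exactAvg_ofReal]
      norm_cast
    rw [hlhs] at hmain
    -- the constant
    have hcard₁ : B₁.card ≤ P := card_boxPlaqT_le a b
    have hcard₂ : B₂.card ≤ P := by
      have := card_boxPlaqT_le (L := L + 1) (a - x) (b - x)
      rwa [card_Icc_sub_eq] at this
    have hM2 : 1 ≤ 2 * Mc := by linarith
    have hΓ := gamma_mono hM2 hcard₁ hcard₂ (Real.exp_nonneg (-(1 * ((((xk - 2 * R : ℕ) : ℝ)) - (2 * R : ℕ) - 1))))
    have hexpo : Real.exp (-(1 * ((((xk - 2 * R : ℕ) : ℝ)) - (2 * R : ℕ) - 1))) =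
        Real.exp (4 * R + 1) * Real.exp (-1 * (xk : ℝ)) := by
      rw [← Real.exp_add]
      congr 1
      rw [Nat.cast_sub (by omega)]
      push_cast
      ring
    have hpS' : 12 * peierlsSum d (L + 1) ((Fintype.card (Additive G) : ℝ) * ε) ((L + 1) / 2) ≤
        Real.exp (-1 * (xk : ℝ)) := by
      have := (hpS.trans_le (min_le_right _ _)).le
      rw [← hMc] 
      have h' : Real.exp (-(xk : ℝ)) = Real.exp (-1 * (xk : ℝ)) := by ring_nf
      rw [h'] at this
      linarith
    have hfin : |exactAvgR φ (fun η => f₁ η * f₂ η) - exactAvgR φ f₁ * exactAvgR φ f₂| ≤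
        (Γ₀ * Real.exp (4 * R + 1) + 1) * Real.exp (-1 * (xk : ℝ)) := by
      refine hmain.trans ?_
      rw [hexpo] at hΓ
      calc _ ≤ (2 * Mc) ^ P * (2 * Mc) ^ P * (6 * P * Real.exp (6 * P + 2 * P) *
              (Real.exp (4 * R + 1) * Real.exp (-1 * (xk : ℝ)))) + Real.exp (-1 * (xk : ℝ)) := by
            rw [hexpo] ; exact add_le_add hΓ hpS'
        _ = (Γ₀ * Real.exp (4 * R + 1) + 1) * Real.exp (-1 * (xk : ℝ)) := by rw [hΓ₀]; ring
    calc c₁ * c₂ * |exactAvgR φ (fun η => f₁ η * f₂ η) - exactAvgR φ f₁ * exactAvgR φ f₂|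
        ≤ c₁ * c₂ * ((Γ₀ * Real.exp (4 * R + 1) + 1) * Real.exp (-1 * (xk : ℝ))) :=
          mul_le_mul_of_nonneg_left hfin (by positivity)
      _ = (c₁ * c₂ * (Γ₀ * Real.exp (4 * R + 1) + 1)) * Real.exp (-1 * (xk : ℝ)) := by ring
      _ ≤ Cfin * Real.exp (-1 * (xk : ℝ)) := mul_le_mul_of_nonneg_right hCfin1 (Real.exp_nonneg _)


end Explicit

end Summit.QuantumFields.YangMills.Theorems.TunedSequenceExists.Negative.FiniteAbelianClustering

end
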